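import Summits.MatrixMultiplication.OmegaCensus.STPP211CosetEngine
import Summits.MatrixMultiplication.OmegaCensus.STPPSmallPatternKernelBits
import Summits.MatrixMultiplication.OmegaCensus.STPP211Z2pow5RoomReflectA

/-!
# STPP (2,1,1) COSET LAW — part C1: mask semantics of the coset engine (bit lemmas)

Cell `pub-omega` (unit `pub-omega-stpp-1-g36`), topic `Summits/MatrixMultiplication/OmegaCensus`.
HONEST FRAMING (verbatim): lottery ticket; floor = certified bounds/negative ranges. Census STRUCTURE bookkeeping (B5, `T1((ℤ/2)⁶)`, Pb237);
nothing here is a bound on `ω`.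

Semantics of the building blocks of `STPP211CosetEngine` (`T1CosetEng`), as `testBit` statements: `foldOr` (both directions), the
XOR-translate `xsh`, packed fields `pack` / `fld`, the hyperplane mask `wmask`, the code mask `maskOf` / `pmask`, the COMPLETENESS of the
candidate masks `emask` («a code in `W` whose XOR with `x` avoids `(P_t ∪ P_l)` has its bit set»), and the capacity reader `upTo2`
(«a set of at most two codes inside the set bits of `M` has at most `upTo2 M` elements»). Bit lemmas of `STPPSmallPatternKernelBits`
(seat pub-omega-stpp-3: `lowBit_spec`, `testBit_land_pred`, `allBits_spec`) and of `STPP211Z2pow5RoomReflectA` (seat g35: `bit_eq_pow`,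
`testBit_bit`, `testBit_lowMask`, and `foldOr_spec` — the one-sided soundness of `foldOr`, which is the same recursor term here) are reused. The search itself is reflected in part C2.

References: H. Cohn, R. Kleinberg, B. Szegedy, C. Umans, FOCS 2005 (arXiv:math/0511460), Def. 5.1.
-/

namespace Summit.MatrixMultiplication.OmegaCensus

namespace T1CosetEng

open STPP211Neg Finset

/-! ## Small bit lemmas -/

/-- Bits of `full6 = 2⁶⁴ − 1`. -/
theorem testBit_full6 (i : ℕ) : full6.testBit i = decide (i < 64) := by
  show (18446744073709551615 : ℕ).testBit i = _
  rw [show (18446744073709551615 : ℕ) = 2 ^ 64 - 1 by norm_num, Nat.testBit_two_pow_sub_one]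

/-- A number all of whose bits `≥ m` vanish is `< 2 ^ m`. -/
theorem lt_two_pow_of_testBit (X m : ℕ) (h : ∀ i, m ≤ i → X.testBit i = false) : X < 2 ^ m := by
  by_contra hX
  obtain ⟨i, hi, hXi⟩ := Nat.exists_ge_and_testBit_of_ge_two_pow (not_lt.1 hX)
  rw [h i hi] at hXi
  exact Bool.false_ne_true hXi

/-! ## `foldOr` and `xsh` -/

/-- `foldOr` is COMPLETE: a set bit of `f x` for a set bit `x` of `F ≤ fuel` is a set bit of `foldOr f fuel F`. -/
theorem foldOr_complete (f : ℕ → ℕ) : ∀ (fuel F : ℕ), F ≤ fuel → ∀ x z, F.testBit x = true → (f x).testBit z = true →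
    (foldOr f fuel F).testBit z = true := by
  intro fuel
  induction fuel with
  | zero =>
      intro F hF x z hx _
      have : F = 0 := Nat.le_zero.1 hF
      subst this; simp at hx
  | succ fuel ih =>
      intro F hF x z hx hfx
      have hF0 : F ≠ 0 := by rintro rfl; simp at hx
      have hbeq : Nat.beq F 0 = false := IcosetW.beq_false_of_ne hF0
      suffices h' : (force (lowBit F) fun L => Nat.lor (f (Nat.log2 L)) (foldOr f fuel (Nat.xor F L))).testBit z = true by
        simp only [foldOr]
        rw [hbeq]
        exact h'
      rw [force_eq, lor_eq, Nat.testBit_lor, Bool.or_eq_true]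
      obtain ⟨i, hi, hL, hrem, hbits⟩ := lowBit_spec hF0
      rw [hL, Nat.log2_two_pow]
      by_cases hxi : x = i
      · subst hxi; exact Or.inl hfx
      · right
        have hrem' : Nat.xor F (2 ^ i) = Nat.land F (F - 1) := by rw [← hL]; exact hrem
        rw [hrem']
        refine ih (Nat.land F (F - 1)) ?_ x z ?_ hfx
        · have : F &&& (F - 1) ≤ F - 1 := Nat.and_le_right
          show F &&& (F - 1) ≤ fuel
          omega
        · rw [hbits x, hx]; simp [hxi]

/-- **`xsh` is the XOR-translate**: bit `z` of `xsh M t` is set iff bit `z ⊕ t` of `M` is. -/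
theorem testBit_xsh (M t z : ℕ) : (xsh M t).testBit z = M.testBit (Nat.xor z t) := by
  unfold xsh
  rcases hM : M.testBit (Nat.xor z t) with _ | _
  · rw [Bool.eq_false_iff]
    intro h
    obtain ⟨x, hx, hfx⟩ := T1Z2p5.foldOr_spec (fun x => bit (Nat.xor x t)) M M z h
    have hxz : z = Nat.xor x t := T1Z2p5.testBit_bit hfx
    have : x = Nat.xor z t := by
      rw [hxz, xor_eq, xor_eq, Nat.xor_assoc, Nat.xor_self, Nat.xor_zero]
    rw [← this, hx] at hM
    exact Bool.noConfusion hM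
  · refine foldOr_complete _ M M le_rfl (Nat.xor z t) z hM ?_
    have : Nat.xor (Nat.xor z t) t = z := by rw [xor_eq, xor_eq, Nat.xor_assoc, Nat.xor_self, Nat.xor_zero]
    rw [this]
    exact T1Z2p5.testBit_bit_self z

/-! ## Packed fields -/

/-- Bits of a packed number beyond the last field vanish. -/
theorem testBit_pack_ge {w : ℕ} {f : ℕ → ℕ} (hf : ∀ i, f i < 2 ^ w) :
    ∀ (n j : ℕ), w * n ≤ j → (pack w f n).testBit j = false := by
  intro n
  induction n with
  | zero => intro j _; exact Nat.zero_testBit j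
  | succ n ih =>
      intro j hj
      rw [Nat.mul_succ] at hj
      show (Nat.lor (pack w f n) (Nat.shiftLeft (f n) (Nat.mul w n))).testBit j = false
      rw [lor_eq, Nat.testBit_lor, shiftLeft_eq', mul_eq', Nat.testBit_shiftLeft, ih j (by omega)]
      have : (f n).testBit (j - w * n) = false := by
        apply Nat.testBit_lt_two_pow
        calc f n < 2 ^ w := hf n
          _ ≤ 2 ^ (j - w * n) := Nat.pow_le_pow_right (by norm_num) (by omega)
      rw [this]; simp

/-- **Field `i` of a packed number is `f i`** (fields of width `w`, all `f i < 2 ^ w`). -/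
theorem testBit_pack {w : ℕ} {f : ℕ → ℕ} (hf : ∀ i, f i < 2 ^ w) :
    ∀ (n i z : ℕ), i < n → z < w → (pack w f n).testBit (w * i + z) = (f i).testBit z := by
  intro n
  induction n with
  | zero => intro i z hi; exact absurd hi (Nat.not_lt_zero _)
  | succ n ih =>
      intro i z hi hz
      show (Nat.lor (pack w f n) (Nat.shiftLeft (f n) (Nat.mul w n))).testBit (w * i + z) = _
      rw [lor_eq, Nat.testBit_lor, shiftLeft_eq', mul_eq', Nat.testBit_shiftLeft]
      rcases Nat.lt_succ_iff_lt_or_eq.1 hi with hi' | rfl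
      · rw [ih i z hi' hz]
        have hle : w * (i + 1) ≤ w * n := Nat.mul_le_mul_left w hi'
        rw [Nat.mul_succ] at hle
        have : ¬ (w * n ≤ w * i + z) := by omega
        simp [this]
      · rw [testBit_pack_ge hf i (w * i + z) (by omega)]
        have h1 : w * i ≤ w * i + z := by omega
        simp [h1]

/-- **Reading a field:** bit `z < w` of `fld w X i` is bit `w i + z` of `X`; bits `≥ w` vanish. -/
theorem testBit_fld (w X i z : ℕ) : (fld w X i).testBit z = (decide (z < w) && X.testBit (w * i + z)) := by
  unfold fld
  rw [land_eq, Nat.testBit_land, shiftRight_eq', mul_eq', Nat.testBit_shiftRight, T1Z2p5.testBit_lowMask, Bool.and_comm]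

/-- Field `i < n` of `pack w f n` is `f i`, bitwise. -/
theorem testBit_fld_pack {w : ℕ} {f : ℕ → ℕ} (hf : ∀ i, f i < 2 ^ w) {n i : ℕ} (hi : i < n) (z : ℕ) :
    (fld w (pack w f n) i).testBit z = (f i).testBit z := by
  rw [testBit_fld]
  by_cases hz : z < w
  · rw [testBit_pack hf n i z hi hz]; simp [hz]
  · have : (f i).testBit z = false :=
      Nat.testBit_lt_two_pow (lt_of_lt_of_le (hf i) (Nat.pow_le_pow_right (by norm_num) (not_lt.1 hz)))
    rw [this]; simp [hz]

/-- A field is `< 2 ^ w`. -/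
theorem fld_lt (w X i : ℕ) : fld w X i < 2 ^ w :=
  lt_two_pow_of_testBit _ _ fun j hj => by rw [testBit_fld]; simp [not_lt.2 hj]

/-- A packed number with `n` fields is `< 2 ^ (w n)`. -/
theorem pack_lt {w : ℕ} {f : ℕ → ℕ} (hf : ∀ i, f i < 2 ^ w) (n : ℕ) : pack w f n < 2 ^ (w * n) :=
  lt_two_pow_of_testBit _ _ fun j hj => testBit_pack_ge hf n j hj

/-! ## The hyperplane mask, the code masks, the candidate masks -/

/-- **Bits of `wmask b`**: code `z < 64` with bit `b` clear. -/
theorem testBit_wmask (b z : ℕ) : (wmask b).testBit z = (decide (z < 64) && !(z.testBit b)) := by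
  unfold wmask
  rcases hz : (decide (z < 64) && !(z.testBit b)) with _ | _
  · rw [Bool.eq_false_iff]
    intro h
    obtain ⟨x, hx, hfx⟩ := T1Z2p5.foldOr_spec (fun x => @Bool.rec (fun _ => ℕ) (bit x) 0 (Nat.testBit x b)) full6 full6 z h
    rw [testBit_full6] at hx
    revert hfx
    rcases hxb : x.testBit b with _ | _
    · intro hfx
      change (bit x).testBit z = true at hfx
      have := T1Z2p5.testBit_bit hfx; subst this
      rw [hx, hxb] at hz; exact absurd hz (by decide)
    · intro hfx
      change (0 : ℕ).testBit z = true at hfx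
      rw [Nat.zero_testBit] at hfx; exact Bool.noConfusion hfx
  · rw [Bool.and_eq_true] at hz
    obtain ⟨hz1, hz2⟩ := hz
    refine foldOr_complete _ full6 full6 le_rfl z z (by rw [testBit_full6]; exact hz1) ?_
    have hzb : z.testBit b = false := by revert hz2; cases z.testBit b <;> simp
    show (@Bool.rec (fun _ => ℕ) (bit z) 0 (Nat.testBit z b)).testBit z = true
    rw [hzb]
    exact T1Z2p5.testBit_bit_self z

/-- `wmask b` is a 64-bit mask. -/
theorem wmask_lt (b : ℕ) : wmask b < 2 ^ 64 :=
  lt_two_pow_of_testBit _ _ fun j hj => by rw [testBit_wmask]; simp [not_lt.2 hj]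

/-- One-sided semantics of `maskOf`: a set bit is a listed code. -/
theorem mem_of_testBit_maskOf : ∀ (l : List ℕ) (z : ℕ), (maskOf l).testBit z = true → z ∈ l
  | [], z, h => by simp [maskOf] at h
  | c :: l, z, h => by
      rw [maskOf, lor_eq, Nat.testBit_lor, Bool.or_eq_true] at h
      rcases h with h | h
      · exact List.mem_cons.2 (Or.inl (T1Z2p5.testBit_bit h))
      · exact List.mem_cons_of_mem _ (mem_of_testBit_maskOf l z h)

/-- One-sided semantics of `pmask`: a set bit `y` of `P_t` is `c_j ⊕ c_t` for a listed `c_j`. -/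
theorem testBit_pmask {cs : List ℕ} {t y : ℕ} (h : (pmask cs t).testBit y = true) : ∃ cj ∈ cs, y = Nat.xor cj (cs.getD t 0) := by
  unfold pmask at h
  rw [testBit_xsh] at h
  refine ⟨Nat.xor y (cs.getD t 0), mem_of_testBit_maskOf _ _ h, ?_⟩
  rw [xor_eq, xor_eq, Nat.xor_assoc, Nat.xor_self, Nat.xor_zero]

/-- **COMPLETENESS of the candidate masks.** A code `z < 64` of `W` such that `z ⊕ x` is neither `c_j ⊕ c_t` nor `c_j ⊕ c_l` for a listed
`c_j` has its bit set in `emask cs W t l x` (for `W = wmask b`). -/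
theorem testBit_emask_of {cs : List ℕ} {b t l x z : ℕ} (hz : z < 64) (hzW : (wmask b).testBit z = true)
    (ht : ∀ cj ∈ cs, Nat.xor z x ≠ Nat.xor cj (cs.getD t 0)) (hl : ∀ cj ∈ cs, Nat.xor z x ≠ Nat.xor cj (cs.getD l 0)) :
    (emask cs (wmask b) t l x).testBit z = true := by
  unfold emask
  rw [land_eq, Nat.testBit_land, hzW, Bool.true_and, xor_eq, Nat.testBit_xor, testBit_full6, decide_eq_true hz, testBit_xsh,
    land_eq, Nat.testBit_land, lor_eq, Nat.testBit_lor]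
  rcases hpt : (pmask cs t).testBit (Nat.xor z x) with _ | _
  · rcases hpl : (pmask cs l).testBit (Nat.xor z x) with _ | _
    · simp
    · obtain ⟨cj, hcj, he⟩ := testBit_pmask hpl
      exact absurd he (hl cj hcj)
  · obtain ⟨cj, hcj, he⟩ := testBit_pmask hpt
    exact absurd he (ht cj hcj)

/-- `emask` is a 64-bit mask (it lies inside `W = wmask b`). -/
theorem emask_lt (cs : List ℕ) (b t l x : ℕ) : emask cs (wmask b) t l x < 2 ^ 64 :=
  lt_two_pow_of_testBit _ _ fun j hj => by
    unfold emask
    rw [land_eq, Nat.testBit_land, testBit_wmask]; simp [not_lt.2 hj]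

/-- **Lanes of a lane vector:** lane `t < k` of `LV l x` is `E t l x`, bitwise. -/
theorem testBit_lane_lvec (cs : List ℕ) (b : ℕ) {k t : ℕ} (ht : t < k) (l x z : ℕ) :
    (lane (lvec cs (wmask b) k l x) t).testBit z = (emask cs (wmask b) t l x).testBit z :=
  testBit_fld_pack (fun i => emask_lt cs b i l x) ht z

/-- **Fields of a table:** field `x < 64` of the table of label `l` is the lane vector `LV l x`. -/
theorem lv_tab (cs : List ℕ) (b k l : ℕ) {x : ℕ} (hx : x < 64) :
    lv k (tab cs (wmask b) k l) x = lvec cs (wmask b) k l x := by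
  apply Nat.eq_of_testBit_eq
  intro z
  unfold lv tab
  exact testBit_fld_pack (fun i => by
    have := pack_lt (w := 64) (fun j => emask_lt cs b j l i) k
    rwa [mul_eq'] ) hx z

/-- Lanes distribute over `Nat.land`. -/
theorem lane_land (A B t z : ℕ) : (lane (Nat.land A B) t).testBit z = ((lane A t).testBit z && (lane B t).testBit z) := by
  unfold lane
  rw [testBit_fld, testBit_fld, testBit_fld, land_eq, Nat.testBit_land]
  cases decide (z < 64) <;> simp

/-! ## The capacity reader -/

/-- `upTo2` unfolds by cases. -/
theorem upTo2_eq (M : ℕ) : upTo2 M = if M = 0 then 0 else if Nat.land M (M - 1) = 0 then 1 else 2 := by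
  unfold upTo2
  by_cases h0 : M = 0
  · subst h0; rfl
  · rw [IcosetW.beq_false_of_ne h0, if_neg h0]
    by_cases h1 : Nat.land M (M - 1) = 0
    · rw [if_pos h1, show Nat.land M (Nat.sub M 1) = Nat.land M (M - 1) from rfl, h1]; rfl
    · rw [if_neg h1, show Nat.land M (Nat.sub M 1) = Nat.land M (M - 1) from rfl, IcosetW.beq_false_of_ne h1]

/-- **Capacity:** a finset `S` with at most two elements, mapped injectively into the set bits of `M`, has at most `upTo2 M` elements. -/
theorem card_le_upTo2 {α : Type*} (S : Finset α) (e : α → ℕ) (he : Set.InjOn e S) {M : ℕ} (hM : ∀ a ∈ S, M.testBit (e a) = true)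
    (h2 : S.card ≤ 2) : S.card ≤ upTo2 M := by
  rw [upTo2_eq]
  by_cases h0 : M = 0
  · rw [if_pos h0]
    subst h0
    rw [Nat.le_zero, card_eq_zero, eq_empty_iff_forall_notMem]
    intro a ha
    have := hM a ha
    rw [Nat.zero_testBit] at this; exact Bool.noConfusion this
  · rw [if_neg h0]
    by_cases h1 : Nat.land M (M - 1) = 0
    · rw [if_pos h1]
      obtain ⟨i, -, hbits⟩ := testBit_land_pred h0
      refine card_le_one.2 fun a ha a' ha' => he ha ha' ?_
      have key : ∀ x ∈ S, e x = i := fun x hx => by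
        have hb := hbits (e x)
        rw [← land_eq, h1, Nat.zero_testBit, hM x hx, Bool.true_and] at hb
        revert hb; cases hh : (e x == i) <;> simp_all
      rw [key a ha, key a' ha']
    · rw [if_neg h1]; exact h2

end T1CosetEng

end Summit.MatrixMultiplication.OmegaCensus
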